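import Summits.ValiantsHypothesis.ValiantsHypothesis.Theorems.FeketeSOSFeketeSOSHardPaleyRIPAffine

/-!
# Route FeketeSOS — crux `FeketeSOSHard` (stmt-ValiantsHypothesis-3996), line `paley-rip` v3,
# `stub_tameOperator` LIFTS along direct sums with an interval block: tame `D` ⇒ tame `D + [0,k)`
# (the structured-direction induction step of the multiscale programme; any tame coarse set `D`)

Setting of `…PaleyRIPDirectSumBlocks.lean` / `…DirectSumTame.lean` (val-width-3996-p5 g0): `S = D + [0,k)`,
`N = 2k − 1`, rows, blocks `G_{dd'} = Σ_i c_i ρ_d(w_i) ρ_{d'}(w_i)`, and the regrouping BY FREQUENCY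
`Σ_i c_i w_i² = Σ_{j<N} Q_j · e_j` (`pattern_by_frequency`), `Q_j = Σ_i (c_i/N) V_{ij}²` a family of `r` weighted
squares supported on `D`.  There, `D` was SIDON-spaced relative to `[0, 2k−1)` and each `Q_j` was re-represented
by `lowRank_rep` (`√r ‖C_j‖_F`) with `Σ_j ‖C_j‖_F ≤ ‖y‖₂` by Parseval.  Here the Sidon hypothesis on `D` is
replaced by

* BLOCK SEPARATION mod `p`: the residues `e + f (mod p)`, `e ∈ D + D`, `f < 2k − 1`, determine `e` AND `f`
  (not the pair `{d,d'}` — `D` itself may have any additive structure), and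
* `T` ON `D` as a HYPOTHESIS, in the registered stub's cyclic vocabulary at rank `r` with bound `B · M'`,

and the conclusion is `T` on `D + [0,k)` at rank `r` with bound `(2k−1) · (Nat.log 2 k + 5/2) · B · M`
(`tameOperator_lift_directSum`).  Since `#(D + [0,k)) = k · #D`, a bound `B = K · #D^{1+ε}` for `D` lifts to
`≤ 2K (log₂ k + 5/2) · #D^ε · #S^{1}·…` — the exponent is preserved up to the factor `2 log₂ k + 5`.  The key new
estimate is `freqSlice_coeff_norm_le`: under block separation every frequency slice `Q_j` has pattern
coefficients `Q_j(e) = (1/N) Σ_{f<N} ζ^{jf} y_{e+f}` of modulus `≤ M` (no Parseval, no rank), so `T` on `D`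
applies to it with the same `M`; the cyclic fold of `Q_j` has the same coefficient bound because `D + D` has
distinct residues.  Then `rep_mul` with `exp_rep` (`e_j` costs `≤ ⌊log₂ k⌋ + 5/2` on `[0,k)`, piece (B)) and
`rep_sum` over the `N` frequencies.

With `…PaleyRIPAffine.lean` (affine invariance) and the landed base cases (Sidon: `lowRank_rep`; small doubling:
`tameOperator_spread`; near-uniform fibres: `tameOperator_of_nearUniformFibres`; direct sumsets:
`tameOperator_of_directSum`) this gives `T` with exponent `1 + o(1)` on every ITERATED structure
`a_J(⋯(a_1(D + [0,k_1)) + [0,k_2))⋯) + [0,k_J) (mod p)` of bounded depth over a tame base `D`, each level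
block-separated — proper multi-dimensional progressions over tame bases.  What is NOT covered: coarse sets whose
blocks interleave (no separation), cluster-free supports in the window `m^{3/2} < diam < m²`, and the
unstructured/inverse step (census §10).

Honest framing (rung currency): a Theorems-side helper `--supports` stmt-3996; nothing here closes a registered
stub; `stub_tameOperator` (all supports), the engine `stub_paleyFlatRIP` and the crux stay OPEN; `VP ≠ VNP` is
untouched.
-/

set_option linter.dupNamespace false

namespace Summit.ValiantsHypothesis.ValiantsHypothesis.Theorems.FeketeSOSHardPaleyRIP

open Polynomial Finset
open scoped BigOperators

noncomputable section

section Lift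

variable (p : ℕ) [Fact p.Prime]

omit [Fact p.Prime] in
/-- **Frequency slices have bounded pattern coefficients under block separation.**  With rows `ρ`, blocks
`G_{dd'}` and `N = 2k−1` as in `…DirectSumBlocks.lean`, `|x| = 1`, and `|y_n| ≤ M` for the pattern
`y = Σ_i c_i w_i²`: the slice `Q = Σ_i (c_i/N) (Σ_d ρ_d(w_i)(x) X^d)²` has `|Q_e| ≤ M` for every `e`, because
`Q_e = (1/N) Σ_{f<N} x^f y_{e+f}` when `e ∈ D + D` (the blocks of `y` at distinct `e ∈ D + D` do not interleave)
and `Q_e = 0` otherwise. [folklore] -/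
theorem freqSlice_coeff_norm_le (D : Finset ℕ) (k : ℕ) (hk : 1 ≤ k)
    (hBN : ∀ d₁ ∈ D, ∀ d₁' ∈ D, ∀ d₂ ∈ D, ∀ d₂' ∈ D, ∀ f₁ < 2 * k - 1, ∀ f₂ < 2 * k - 1,
      d₁ + d₁' + f₁ = d₂ + d₂' + f₂ → d₁ + d₁' = d₂ + d₂' ∧ f₁ = f₂)
    (hdirect : ∀ d ∈ D, ∀ h < k, ∀ d' ∈ D, ∀ h' < k, d + h = d' + h' → d = d')
    (r : ℕ) (c : Fin r → ℂ) (w : Fin r → ℂ[X])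
    (hw : ∀ i, (w i).support ⊆ (D ×ˢ range k).image (fun x => x.1 + x.2))
    (ρ : Fin r → ℕ → ℂ[X]) (hρ : ∀ i d, ρ i d = ∑ h ∈ range k, C ((w i).coeff (d + h)) * (X : ℂ[X]) ^ h)
    (x : ℂ) (hx : ‖x‖ = 1) (M : ℝ) (hM0 : 0 ≤ M) (hyM : ∀ n, ‖(∑ i, C (c i) * w i ^ 2).coeff n‖ ≤ M)
    (e : ℕ) :
    ‖(∑ i, C (c i / ((2 * k - 1 : ℕ) : ℂ)) * (∑ d ∈ D, C ((ρ i d).eval x) * (X : ℂ[X]) ^ d) ^ 2).coeff e‖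
      ≤ M := by
  classical
  have hN : 0 < 2 * k - 1 := by omega
  set N : ℕ := 2 * k - 1 with hNdef
  -- the block polynomials and their coefficients
  set blk : ℕ → ℕ → ℂ[X] := fun d d' => ∑ i, C (c i) * (ρ i d * ρ i d') with hblk
  have hblk_deg : ∀ d d', (blk d d').natDegree < N := fun d d' =>
    natDegree_block_lt k hk r c w d d' ρ hρ
  -- the slice coefficient as a double sum of Gram entries
  have hQcoeff : (∑ i, C (c i / (N : ℂ)) * (∑ d ∈ D, C ((ρ i d).eval x) * (X : ℂ[X]) ^ d) ^ 2).coeff e =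
      ∑ d ∈ D, ∑ d' ∈ D, if e = d + d' then (1 / (N : ℂ)) * (blk d d').eval x else 0 := by
    rw [sum_C_mul_sq_coeffPoly D r (fun i => c i / (N : ℂ)) (fun i d => (ρ i d).eval x),
      coeff_sum_sum_monomial]
    refine Finset.sum_congr rfl fun d _ => Finset.sum_congr rfl fun d' _ => ?_
    congr 1
    rw [eval_block, Finset.mul_sum]
    exact Finset.sum_congr rfl fun i _ => by ring
  -- block evaluation as a coefficient sum
  have heval : ∀ d d', (blk d d').eval x = ∑ f ∈ range N, (blk d d').coeff f * x ^ f := fun d d' =>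
    eval_eq_sum_range' (hblk_deg d d') x
  by_cases he : ∃ t ∈ D ×ˢ D, t.1 + t.2 = e
  · obtain ⟨⟨d₀, d₀'⟩, ht₀, he₀⟩ := he
    rw [Finset.mem_product] at ht₀
    simp only at he₀
    -- the pattern on the block `e + [0,N)` is the `e`-th block sum
    have hyblock : ∀ f < N, (∑ i, C (c i) * w i ^ 2).coeff (e + f) =
        ∑ d ∈ D, ∑ d' ∈ D, if e = d + d' then (blk d d').coeff f else 0 := by
      intro f hf
      rw [coeff_pattern_eq_fiber_sum D k hk hdirect r c w hw ρ hρ (e + f), Finset.sum_filter,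
        Finset.sum_product, Finset.sum_product]
      refine Finset.sum_congr rfl fun d hd => Finset.sum_congr rfl fun d' hd' => ?_
      by_cases hdd : e = d + d'
      · rw [if_pos hdd]
        have hiff : ∀ f' : ℕ, ((d, d'), f').1.1 + ((d, d'), f').1.2 + ((d, d'), f').2 = e + f ↔ f' = f := by
          intro f'
          simp only
          omega
        simp only [hiff]
        rw [Finset.sum_ite_eq' (range N) f, if_pos (mem_range.2 hf)]
      · rw [if_neg hdd]
        refine Finset.sum_eq_zero fun f' hf' => if_neg fun h => hdd ?_
        simp only at h
        have := (hBN d hd d' hd' d₀ ht₀.1 d₀' ht₀.2 f' (mem_range.1 hf') f hf (by omega)).1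
        omega
    -- hence `Q_e = (1/N) Σ_f x^f y_{e+f}`
    have hQe : (∑ i, C (c i / (N : ℂ)) * (∑ d ∈ D, C ((ρ i d).eval x) * (X : ℂ[X]) ^ d) ^ 2).coeff e =
        ∑ f ∈ range N, (1 / (N : ℂ)) * x ^ f * (∑ i, C (c i) * w i ^ 2).coeff (e + f) := by
      rw [hQcoeff]
      symm
      calc ∑ f ∈ range N, (1 / (N : ℂ)) * x ^ f * (∑ i, C (c i) * w i ^ 2).coeff (e + f)
          = ∑ f ∈ range N, ∑ d ∈ D, ∑ d' ∈ D,
              (1 / (N : ℂ)) * x ^ f * (if e = d + d' then (blk d d').coeff f else 0) := by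
            refine Finset.sum_congr rfl fun f hf => ?_
            rw [hyblock f (mem_range.1 hf), Finset.mul_sum]
            exact Finset.sum_congr rfl fun d _ => by rw [Finset.mul_sum]
        _ = ∑ d ∈ D, ∑ d' ∈ D, ∑ f ∈ range N,
              (1 / (N : ℂ)) * x ^ f * (if e = d + d' then (blk d d').coeff f else 0) := by
            rw [Finset.sum_comm]
            exact Finset.sum_congr rfl fun d _ => Finset.sum_comm
        _ = ∑ d ∈ D, ∑ d' ∈ D, if e = d + d' then (1 / (N : ℂ)) * (blk d d').eval x else 0 := by
            refine Finset.sum_congr rfl fun d _ => Finset.sum_congr rfl fun d' _ => ?_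
            by_cases hdd : e = d + d'
            · simp only [if_pos hdd]
              rw [heval, Finset.mul_sum]
              exact Finset.sum_congr rfl fun f _ => by ring
            · simp only [if_neg hdd, mul_zero, Finset.sum_const_zero]
    rw [hQe]
    calc ‖∑ f ∈ range N, 1 / (N : ℂ) * x ^ f * (∑ i, C (c i) * w i ^ 2).coeff (e + f)‖
        ≤ ∑ f ∈ range N, ‖1 / (N : ℂ) * x ^ f * (∑ i, C (c i) * w i ^ 2).coeff (e + f)‖ :=
          norm_sum_le _ _
      _ ≤ ∑ f ∈ range N, (1 / (N : ℝ)) * M := Finset.sum_le_sum fun f _ => by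
          rw [norm_mul, norm_mul, norm_pow, hx, one_pow, mul_one, norm_div, norm_one,
            Complex.norm_natCast]
          exact mul_le_mul_of_nonneg_left (hyM _) (by positivity)
      _ = M := by
          rw [Finset.sum_const, card_range, nsmul_eq_mul]
          have hN' : (N : ℝ) ≠ 0 := by exact_mod_cast hN.ne'
          field_simp
  · -- `e ∉ D + D`: the slice coefficient vanishes
    have h0 : (∑ i, C (c i / (N : ℂ)) * (∑ d ∈ D, C ((ρ i d).eval x) * (X : ℂ[X]) ^ d) ^ 2).coeff e
        = 0 := by
      rw [hQcoeff]
      refine Finset.sum_eq_zero fun d hd => Finset.sum_eq_zero fun d' hd' => if_neg fun h => he ?_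
      exact ⟨(d, d'), Finset.mem_product.2 ⟨hd, hd'⟩, h.symm⟩
    rw [h0, norm_zero]
    exact hM0

omit [Fact p.Prime] in
/-- Exponents of a family of weighted squares supported on `D` lie in `D + D`. [folklore] -/
theorem exists_add_eq_of_mem_support_sq (D : Finset ℕ) (r : ℕ) (a : Fin r → ℂ) (b : Fin r → ℕ → ℂ) {e : ℕ}
    (he : e ∈ (∑ i, C (a i) * (∑ d ∈ D, C (b i d) * (X : ℂ[X]) ^ d) ^ 2).support) :
    ∃ d ∈ D, ∃ d' ∈ D, d + d' = e := by
  classical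
  rw [mem_support_iff, sum_C_mul_sq_coeffPoly, coeff_sum_sum_monomial] at he
  by_contra h
  apply he
  refine Finset.sum_eq_zero fun d hd => Finset.sum_eq_zero fun d' hd' => if_neg fun hedd => h ?_
  exact ⟨d, hd, d', hd', hedd.symm⟩

/-- **`stub_tameOperator` lifts along direct sums with an interval block.**  Let `k ≥ 1` and let `D` be
BLOCK-SEPARATED relative to `[0, 2k−1)` mod `p`: `d₁ + d₁' + f₁ ≡ d₂ + d₂' + f₂ (mod p)` (`dᵢ, dᵢ' ∈ D`,
`fᵢ < 2k − 1`) forces `d₁ + d₁' = d₂ + d₂'` and `f₁ = f₂`.  Suppose `T` holds ON `D` at rank `r` with bound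
`B · M'`: every family of `r` weighted squares supported in `D` whose cyclic pattern `P` (`deg P < p`) has
coefficients of modulus `≤ M'` is re-represented on `D` with the same cyclic pattern and mass `≤ B · M'`.  Then
every family of `r` weighted squares supported in `S = D + [0,k)` whose cyclic pattern `F` has coefficients of
modulus `≤ M` is re-represented on `S` with the same cyclic pattern and mass
`≤ (2k − 1) · (Nat.log 2 k + 5/2) · B · M`. [folklore] -/
theorem tameOperator_lift_directSum (D : Finset ℕ) (k : ℕ) (hk : 1 ≤ k)
    (hB : ∀ d₁ ∈ D, ∀ d₁' ∈ D, ∀ d₂ ∈ D, ∀ d₂' ∈ D, ∀ f₁ < 2 * k - 1, ∀ f₂ < 2 * k - 1,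
      ((d₁ + d₁' + f₁ : ℕ) : ZMod p) = ((d₂ + d₂' + f₂ : ℕ) : ZMod p) → d₁ + d₁' = d₂ + d₂' ∧ f₁ = f₂)
    (r : ℕ) (B : ℝ)
    (hTD : ∀ (a : Fin r → ℂ) (v : Fin r → ℂ[X]), (∀ i, (v i).support ⊆ D) →
      ∀ (P : ℂ[X]) (M' : ℝ), P.natDegree < p → ((X : ℂ[X]) ^ p - 1 ∣ (∑ i, C (a i) * v i ^ 2) - P) →
        (∀ n, ‖P.coeff n‖ ≤ M') →
        ∃ (s' : ℕ) (a' : Fin s' → ℂ) (v' : Fin s' → ℂ[X]), (∀ j, (v' j).support ⊆ D) ∧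
          ((X : ℂ[X]) ^ p - 1 ∣ (∑ j, C (a' j) * v' j ^ 2) - P) ∧ (∑ j, sqMass (a' j) (v' j)) ≤ B * M')
    (c : Fin r → ℂ) (w : Fin r → ℂ[X])
    (hw : ∀ i, (w i).support ⊆ (D ×ˢ range k).image (fun x => x.1 + x.2))
    (F : ℂ[X]) (M : ℝ) (hF : F.natDegree < p)
    (hdvd : (X : ℂ[X]) ^ p - 1 ∣ (∑ i, C (c i) * w i ^ 2) - F) (hM : ∀ n, ‖F.coeff n‖ ≤ M) :
    ∃ (s' : ℕ) (c' : Fin s' → ℂ) (w' : Fin s' → ℂ[X]),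
      (∀ j, (w' j).support ⊆ (D ×ˢ range k).image (fun x => x.1 + x.2)) ∧
      ((X : ℂ[X]) ^ p - 1 ∣ (∑ j, C (c' j) * w' j ^ 2) - F) ∧
      (∑ j, sqMass (c' j) (w' j)) ≤ ((2 * k - 1 : ℕ) : ℝ) * ((Nat.log 2 k : ℝ) + 5 / 2) * B * M := by
  classical
  have hprime : p.Prime := Fact.out
  have hp : 0 < p := hprime.pos
  have hM0 : 0 ≤ M := (norm_nonneg _).trans (hM 0)
  have hN : 0 < 2 * k - 1 := by omega
  -- separation in `ℕ`, directness
  have hBN : ∀ d₁ ∈ D, ∀ d₁' ∈ D, ∀ d₂ ∈ D, ∀ d₂' ∈ D, ∀ f₁ < 2 * k - 1, ∀ f₂ < 2 * k - 1,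
      d₁ + d₁' + f₁ = d₂ + d₂' + f₂ → d₁ + d₁' = d₂ + d₂' ∧ f₁ = f₂ :=
    fun d₁ h₁ d₁' h₁' d₂ h₂ d₂' h₂' f₁ hf₁ f₂ hf₂ h =>
      hB d₁ h₁ d₁' h₁' d₂ h₂ d₂' h₂' f₁ hf₁ f₂ hf₂ (by rw [h])
  have hdirect : ∀ d ∈ D, ∀ h < k, ∀ d' ∈ D, ∀ h' < k, d + h = d' + h' → d = d' := by
    intro d hd h hh d' hd' h' hh' heq
    have := (hBN d hd d hd d' hd' d' hd' (2 * h) (by omega) (2 * h') (by omega) (by omega)).1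
    omega
  have hprop : ∀ a₁ ∈ D, ∀ b₁ ∈ range k, ∀ a₂ ∈ D, ∀ b₂ ∈ range k, a₁ + b₁ = a₂ + b₂ → a₁ = a₂ :=
    fun a₁ ha₁ b₁ hb₁ a₂ ha₂ b₂ hb₂ h => hdirect a₁ ha₁ b₁ (mem_range.1 hb₁) a₂ ha₂ b₂ (mem_range.1 hb₂) h
  have hS : ∀ d ∈ D, ∀ h ∈ range k, d + h ∈ (D ×ˢ range k).image (fun x => x.1 + x.2) := fun d hd h hh =>
    Finset.mem_image.2 ⟨(d, h), Finset.mem_product.2 ⟨hd, hh⟩, rfl⟩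
  -- rows, root of unity
  obtain ⟨ρ, hρ⟩ : ∃ ρ : Fin r → ℕ → ℂ[X],
      ∀ i d, ρ i d = ∑ h ∈ range k, C ((w i).coeff (d + h)) * (X : ℂ[X]) ^ h := ⟨_, fun _ _ => rfl⟩
  have hζ := Complex.isPrimitiveRoot_exp (2 * k - 1) hN.ne'
  set ζ : ℂ := Complex.exp (2 * Real.pi * Complex.I / ((2 * k - 1 : ℕ) : ℂ)) with hζdef
  have hζ1 : ‖ζ‖ = 1 := hζ.norm'_eq_one hN.ne'
  -- `|y_n| ≤ M` for the pattern `y` (block separation mod `p` ⇒ no two exponents of `y` collide mod `p`)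
  have hmem : ∀ n ∈ (∑ i, C (c i) * w i ^ 2).support, ∃ d ∈ D, ∃ d' ∈ D, ∃ f < 2 * k - 1,
      n = d + d' + f := by
    intro n hn
    have h := coeff_pattern_eq_fiber_sum D k hk hdirect r c w hw ρ hρ n
    have hne := mem_support_iff.1 hn
    rw [h] at hne
    obtain ⟨t, ht, -⟩ := Finset.exists_ne_zero_of_sum_ne_zero hne
    rw [Finset.mem_filter, Finset.mem_product, Finset.mem_product, mem_range] at ht
    exact ⟨t.1.1, ht.1.1.1, t.1.2, ht.1.1.2, t.2, ht.1.2, ht.2.symm⟩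
  have hinj : ∀ n ∈ (∑ i, C (c i) * w i ^ 2).support, ∀ e ∈ (∑ i, C (c i) * w i ^ 2).support,
      ((e : ℕ) : ZMod p) = ((n : ℕ) : ZMod p) → e = n := by
    intro n hn e he hcast
    obtain ⟨d₁, h₁, d₁', h₁', f₁, hf₁, rfl⟩ := hmem e he
    obtain ⟨d₂, h₂, d₂', h₂', f₂, hf₂, rfl⟩ := hmem n hn
    obtain ⟨hdd, hf⟩ := hB d₁ h₁ d₁' h₁' d₂ h₂ d₂' h₂' f₁ hf₁ f₂ hf₂ hcast
    omega
  have hyM : ∀ n, ‖(∑ i, C (c i) * w i ^ 2).coeff n‖ ≤ M := by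
    intro n
    by_cases hn : n ∈ (∑ i, C (c i) * w i ^ 2).support
    · have h := coeff_cyclic_eq_sum_support p _ F hF hdvd ((n : ℕ) : ZMod p)
      rw [Finset.sum_eq_single_of_mem n hn fun e he hne => if_neg fun hcast => hne (hinj n hn e he hcast),
        if_pos rfl] at h
      rw [← h]
      exact hM _
    · rw [notMem_support_iff.1 hn, norm_zero]
      exact hM0
  -- the frequency decomposition `y = Σ_j Q_j · E_j`
  obtain ⟨V, hV⟩ : ∃ V : Fin r → ℕ → ℂ[X],
      ∀ i j, V i j = ∑ d ∈ D, C ((ρ i d).eval (ζ ^ j)) * (X : ℂ[X]) ^ d := ⟨_, fun _ _ => rfl⟩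
  obtain ⟨Q, hQ⟩ : ∃ Q : ℕ → ℂ[X],
      ∀ j, Q j = ∑ i, C (c i / ((2 * k - 1 : ℕ) : ℂ)) * V i j ^ 2 := ⟨_, fun _ => rfl⟩
  obtain ⟨E, hE⟩ : ∃ E : ℕ → ℂ[X], ∀ j, E j =
      ∑ n ∈ range (2 * k - 1), C ((ζ ^ (j * (2 * k - 1 - 1))) ^ n) * (X : ℂ[X]) ^ n := ⟨_, fun _ => rfl⟩
  have hpf : (∑ i, C (c i) * w i ^ 2) = ∑ j ∈ range (2 * k - 1), Q j * E j := by
    rw [pattern_by_frequency D k hk hdirect r c w hw ρ hρ ζ hζ]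
    refine Finset.sum_congr rfl fun j _ => ?_
    rw [hQ, hE]
    simp only [hV]
  have hVsupp : ∀ i j, (V i j).support ⊆ D := fun i j => by
    rw [hV]; exact support_sum_C_mul_X_pow_subset D _
  -- each slice: bounded coefficients, tame on `D` (hypothesis), times `E_j` on `[0,k)`
  have hfreq : ∀ j : ℕ, ∃ A : ℂ[X], ((X : ℂ[X]) ^ p - 1 ∣ A - Q j) ∧
      ∃ (s : ℕ) (c' : Fin s → ℂ) (w' : Fin s → ℂ[X]),
        (∀ l, (w' l).support ⊆ (D ×ˢ range k).image (fun x => x.1 + x.2)) ∧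
        (∑ l, C (c' l) * w' l ^ 2) = A * E j ∧
        (∑ l, sqMass (c' l) (w' l)) ≤ B * M * ((Nat.log 2 k : ℝ) + 5 / 2) := by
    intro j
    have hx : ‖ζ ^ j‖ = 1 := by rw [norm_pow, hζ1, one_pow]
    -- coefficient bound of the slice
    have hQM : ∀ e, ‖(Q j).coeff e‖ ≤ M := fun e => by
      rw [hQ]
      simp only [hV]
      exact freqSlice_coeff_norm_le D k hk hBN hdirect r c w hw ρ hρ (ζ ^ j) hx M hM0 hyM e
    -- cyclic fold of the slice
    set P : ℂ[X] := ∑ e ∈ (Q j).support, C ((Q j).coeff e) * X ^ (e % p) with hPdef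
    have hPdeg : P.natDegree < p := FeketeSOSHardSketch.grt_natDegree_fold_lt (Q j) hp
    have hPQ : (X : ℂ[X]) ^ p - 1 ∣ P - Q j := FeketeSOSHardSketch.grt_X_pow_sub_one_dvd_fold_sub (Q j) p
    have hQP : (X : ℂ[X]) ^ p - 1 ∣ Q j - P := by rw [← dvd_neg, neg_sub]; exact hPQ
    -- exponents of `Q j` are in `D + D`, whose residues are distinct
    have hsuppQ : ∀ e ∈ (Q j).support, ∃ d ∈ D, ∃ d' ∈ D, d + d' = e := fun e he => by
      rw [hQ] at he
      simp only [hV] at he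
      exact exists_add_eq_of_mem_support_sq D r _ _ he
    have hinjQ : ∀ e₁ ∈ (Q j).support, ∀ e₂ ∈ (Q j).support, e₁ % p = e₂ % p → e₁ = e₂ := by
      intro e₁ he₁ e₂ he₂ hmod
      obtain ⟨d₁, h₁, d₁', h₁', rfl⟩ := hsuppQ e₁ he₁
      obtain ⟨d₂, h₂, d₂', h₂', rfl⟩ := hsuppQ e₂ he₂
      have hcast : ((d₁ + d₁' + 0 : ℕ) : ZMod p) = ((d₂ + d₂' + 0 : ℕ) : ZMod p) := by
        rw [add_zero, add_zero]
        exact (ZMod.natCast_eq_natCast_iff' _ _ _).2 hmod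
      exact (hB d₁ h₁ d₁' h₁' d₂ h₂ d₂' h₂' 0 hN 0 hN hcast).1
    have hPM : ∀ ν, ‖P.coeff ν‖ ≤ M := by
      intro ν
      have hPν : P.coeff ν = ∑ e ∈ (Q j).support, if ν = e % p then (Q j).coeff e else 0 := by
        rw [hPdef, finsetSum_coeff]
        exact Finset.sum_congr rfl fun e _ => by rw [coeff_C_mul_X_pow]
      by_cases hex : ∃ e ∈ (Q j).support, ν = e % p
      · obtain ⟨e₀, he₀, hν⟩ := hex
        rw [hPν, Finset.sum_eq_single_of_mem e₀ he₀ fun e he hne => if_neg fun h =>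
          hne (hinjQ e he e₀ he₀ (by rw [← h, ← hν])), if_pos hν]
        exact hQM e₀
      · rw [hPν, Finset.sum_eq_zero fun e he => if_neg fun h => hex ⟨e, he, h⟩, norm_zero]
        exact hM0
    -- `T` on `D`
    obtain ⟨s', a', v', hv', hdvd', hmass'⟩ :=
      hTD (fun i => c i / ((2 * k - 1 : ℕ) : ℂ)) (fun i => V i j) (fun i => hVsupp i j) P M hPdeg
        (by rw [← hQ]; exact hQP) hPM
    refine ⟨∑ l, C (a' l) * v' l ^ 2, ?_, ?_⟩
    · have := dvd_add hdvd' hPQ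
      rwa [sub_add_sub_cancel] at this
    · have hu : ‖ζ ^ (j * (2 * k - 1 - 1))‖ = 1 := by rw [norm_pow, hζ1, one_pow]
      have hrepA : ∃ (s : ℕ) (c₀ : Fin s → ℂ) (w₀ : Fin s → ℂ[X]), (∀ l, (w₀ l).support ⊆ D) ∧
          (∑ l, C (c₀ l) * w₀ l ^ 2) = ∑ l, C (a' l) * v' l ^ 2 ∧ (∑ l, sqMass (c₀ l) (w₀ l)) ≤ B * M :=
        ⟨s', a', v', hv', rfl, hmass'⟩
      have h := rep_mul hprop hS hrepA (exp_rep k hk _ hu)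
      rw [← hE] at h
      exact h
  choose A hAQ hArep using hfreq
  obtain ⟨s', c', w', hsupp', heq', hmass'⟩ :=
    rep_sum (range (2 * k - 1)) ((D ×ˢ range k).image (fun x => x.1 + x.2)) (fun j => A j * E j)
      (fun _ => B * M * ((Nat.log 2 k : ℝ) + 5 / 2)) fun j _ => hArep j
  refine ⟨s', c', w', hsupp', ?_, hmass'.trans (le_of_eq ?_)⟩
  · rw [heq']
    have hsplit : (∑ j ∈ range (2 * k - 1), A j * E j) - F =
        (∑ j ∈ range (2 * k - 1), (A j - Q j) * E j) + ((∑ j ∈ range (2 * k - 1), Q j * E j) - F) := by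
      simp only [sub_mul, Finset.sum_sub_distrib]
      ring
    rw [hsplit]
    refine dvd_add (Finset.dvd_sum fun j _ => (hAQ j).mul_right _) ?_
    rw [← hpf]
    exact hdvd
  · rw [Finset.sum_const, card_range, nsmul_eq_mul]
    ring

end Lift

end

end Summit.ValiantsHypothesis.ValiantsHypothesis.Theorems.FeketeSOSHardPaleyRIP
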